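import Summits.QuantumFields.BalabanUV.Beta.FP.SliceLoopWindowLetters

/-!
# `BalabanUV.Beta.FP.SliceLoopWindowTerms` — road «FP» (binder row D1), organisation γ, row **GAMMA-6 (W) «WINDOW LETTERS»** (owner ruling R-FP-28 (c),
# journal l.25755), PART 2: THE THREE ROW-MASS LETTERS OF ONE LEIBNIZ-PLACED WINDOWED TERM — (K̃) for the by-parts kernel `k̃ = χ·ρ·G`, (K₀-interior) and
# (K₀-shell) for the plain kernel `k₀` of `FP/SliceLoopPairing.kernel_leibniz`, from a sup letter and a unit-difference letter on the smooth leg `ρ` and a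
# degree-`m` window decay letter on the long leg `G` (m = 3: the leg carries its one difference; m = 2: the undifferenced leg against a differenced smooth leg),
# with the window sums `W₃(N) = 1 + 80N`, `W₂(N) = 1 + 80N²` of PART 1 ([folklore] lattice bookkeeping; no road object is typed or touched)

HONEST DEPENDENCY (page 1, mandatory): continuum YM on T⁴ ⇐ BetaPertH ∧ nine spine estimates (0/9 proved); BetaPertH ⇐ (D1) ∧ (D4) ∧
CAP+tail; G-an2-4 gates asym, D1 and NE2/3/4.  HONEST FRAMING (cell contract, verbatim): «discharging `BetaPertH` makes Bałaban's UV
stability UNCONDITIONAL — a real constructive-QFT result; it is NOT the continuum limit and NOT the Clay problem.»  THIS MODULE is elementary [folklore]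
real analysis on `ℤ⁴ = DyadicShell.Pt` over PART 1 `FP/SliceLoopWindowLetters` BY NAME (`rowMass_le_of_window`, `sum_box_inv_sq_le`, `FP/GhostLoopCountingWindow.sum_box_inv_cube_le` ✓,
`inv_pow_unit_shift_le`, the window's jump bookkeeping); every analytic input is a HYPOTHESIS displayed in the signatures (hypotheses-as-definitions for the
kernels, exactly the shapes of `SliceLoopPairing.kernel_leibniz` ∕ `pp_of_leibniz`).  It cites nothing, defines nothing, mints no `Prop` fact, 0 sorry.  NOT the
smeared cross kernel's `q`-summed (pp) (the instantiator sums these letters over the vertex offsets with `NearRegionCrossBubbleSmear.abs_tsum_cross_le_of_pow` ✓),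
NOT (pp)∕(rem) for any road piece, NOT hbook, NOT D1, NOT BetaPertH, NOT continuum, NOT Clay.

ABSOLUTE RULE (cell charter, verbatim): «No internally-minted statement may enter as a cited fact. Every hypothesis is either kernel-proved in this
package or a verbatim quotation of a PUBLISHED theorem with page reference. The manuscript(s) under audit are NOT citable for their own disputed
steps — they are the thing under adjudication; programme-internal (2001/route/tribunal) claims are never citable.»

THE LETTERS (all displayed; `γ ≥ 0` the column-profile rate and `n ≥ 1` the blocking of the (pp) currency, `N ≥ 1` the window radius, `‖w‖∞ ≤ 1` the unit shift
paired with the column):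
* window `χ b b′ = 𝟙[‖b′−b‖∞ ≤ N]`;  smooth leg (ρ0) `|ρ b b′| ≤ Bρ₀`, (ρ1) `|ρ b (b′+w) − ρ b b′| ≤ Bρ₁`;  long leg (Gm) `|G b b′| ≤ A∕(‖b′−b‖∞+1)ᵐ`;
* the window sum `W` of degree `m`: `Σ_{‖z‖∞ ≤ N} (‖z‖∞+1)⁻ᵐ ≤ W` (PART 1: `W₃ = 1 + 80N`, `W₂ = 1 + 80N²`).
PLACEMENT TABLE ↔ DEGREES (R-FP-28 (c), `SliceLoopPairing` §5): `k̃ ∋ (Δ_yF)·R` [m = 3, `A ≍ A₁|y|`, `Bρ₀ = B₀ ≍ B·n⁻²`] and `F·Δ_uR` [m = 2, `A = A₀`, `Bρ₀ ≍ B₁|u| ≍ B·n⁻³`];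
`k₀`-interior ∋ `(Δ_yF)·Δ⁽²⁾R` [m = 3, `Bρ₁ = B₁`], `F·Δ_uΔ⁽²⁾R` [m = 2, `Bρ₁ ≍ B₂|u| ≍ B·n⁻⁴`]; shell ∋ the `Bρ₀` versions.  ROAD SIZES (`N = R₀n`): (K̃)₃ `≍ A₁B·R₀·n⁻¹`,
(K̃)₂ `≍ A₀B·R₀²·n⁻¹`, (K₀-int)₃ `≍ A₁B·R₀·n⁻²`, (K₀-int)₂ `≍ A₀B·R₀²·n⁻²`, shells `≍ A₁B·n⁻²`, `A₀B·R₀·n⁻²` — with the columns' `C₂ ≍ c∕n`, `C_Δ ≍ c′∕n²` and the window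
factor `n⁴` of `pp_of_pairs` every piece is n-FREE (`CoarseContractionProfile.road_units_bookkeeping` ✓); NO logarithm anywhere.

CONTENT: **`rowMass_kt_le`** (K̃), **`rowMass_k0_interior_le`**, **`rowMass_k0_shell_le`**, the assembled **`rowMass_k0_le`** (K₀), each for a general degree `m`
against a displayed window-sum letter `W`; `rowMass_kt_le_three` ∕ `rowMass_k0_le_three` (the m = 3 instances with PART 1's `W₃`, the R-γ-15 channel repaired).
Unit `b2b-balaban-gan24-formalise-leaf-05` (gen 37; G-an2-4 swarm leaf seat, cross-lane on road FP; first refusal R-FP-28 (c)), 2026-08-21; `LEAVES-FP.md` row GAMMA-6;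
journal MINE l.26308.  «not in print; our bookkeeping».
-/

noncomputable section

namespace Summit.QuantumFields.BalabanUV.Beta.FP.SliceLoopWindowTerms

open Finset Real
open scoped BigOperators
open Literature.Probability.LatticeModels (box annulus)
open Literature.MathematicalPhysics.QuantumFieldTheory.Balaban1983to89.Beta
open DyadicShell (Pt supNorm mem_box_iff)
open Summit.QuantumFields.BalabanUV.Beta.FP.SliceLoopWindowLetters
open Summit.QuantumFields.BalabanUV.Beta.FP.GhostLoopCountingWindow (sum_box_inv_cube_le)

variable {γ A Bρ₀ Bρ₁ W : ℝ} {n N m : ℕ} {χ ρ G kt k₀i k₀s k₀ : Pt → Pt → ℝ} {w : Pt}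

/-- **(K̃) THE BY-PARTS KERNEL's ROW MASS** (row GAMMA-6 (W)): for `k̃ b b′ = χ b b′·ρ b b′·G b b′` with the window `χ = 𝟙[‖b′−b‖∞ ≤ N]`, the smooth-leg sup
letter (ρ0) `|ρ b b′| ≤ Bρ₀`, the long-leg degree-`m` letter (Gm) `|G b b′| ≤ A∕(‖b′−b‖∞+1)ᵐ` and the window sum `Σ_{‖z‖∞≤N}(‖z‖∞+1)⁻ᵐ ≤ W`:
`Σ_{b′∈S′} e^{(γ∕(2n))‖b′−b‖∞}·|k̃ b b′| ≤ e^{(γ∕(2n))N}·Bρ₀·A·W` (m = 3, `W = 1+80N`: `≍ A·B·R₀·n⁻¹` = the (K̃) size of R-FP-28 (c)). [folklore] -/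
theorem rowMass_kt_le (hγ : 0 ≤ γ) (hA : 0 ≤ A) (hB : 0 ≤ Bρ₀)
    (hχ : ∀ b b', χ b b' = if supNorm (b' - b) ≤ N then 1 else 0)
    (hρ : ∀ b b', |ρ b b'| ≤ Bρ₀) (hG : ∀ b b', |G b b'| ≤ A / ((supNorm (b' - b) : ℝ) + 1) ^ m)
    (hW : ∑ z ∈ box 4 N, (((supNorm z : ℝ) + 1) ^ m)⁻¹ ≤ W)
    (hkt : ∀ b b', kt b b' = χ b b' * ρ b b' * G b b') (b : Pt) (S' : Finset Pt) :
    ∑ b' ∈ S', Real.exp ((γ / (2 * n)) * (supNorm (b' - b) : ℝ)) * |kt b b'|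
      ≤ Real.exp ((γ / (2 * n)) * N) * (Bρ₀ * A * W) := by
  have hpt : ∀ b', |kt b b'| ≤ (fun z : Pt => Bρ₀ * A * (((supNorm z : ℝ) + 1) ^ m)⁻¹) (b' - b) := by
    intro b'
    simp only
    rw [hkt, abs_mul, abs_mul]
    calc |χ b b'| * |ρ b b'| * |G b b'| ≤ 1 * Bρ₀ * (A / ((supNorm (b' - b) : ℝ) + 1) ^ m) :=
          mul_le_mul (mul_le_mul (abs_window_le_one hχ b b') (hρ b b') (abs_nonneg _) zero_le_one) (hG b b') (abs_nonneg _)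
            (mul_nonneg zero_le_one hB)
      _ = Bρ₀ * A * (((supNorm (b' - b) : ℝ) + 1) ^ m)⁻¹ := by ring
  have hsupp : ∀ b', kt b b' ≠ 0 → supNorm (b' - b) ≤ N := by
    intro b' hne
    by_contra hN
    apply hne
    rw [hkt, hχ, if_neg hN]; ring
  have h := rowMass_le_of_window (n := n) hγ b (φ := fun z : Pt => Bρ₀ * A * (((supNorm z : ℝ) + 1) ^ m)⁻¹) hpt hsupp S'
  refine h.trans (mul_le_mul_of_nonneg_left ?_ (Real.exp_pos _).le)
  rw [← Finset.mul_sum]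
  exact mul_le_mul_of_nonneg_left hW (mul_nonneg hB hA)

/-- **(K₀, INTERIOR) ROW MASS** (row GAMMA-6 (W)): for `k₀ⁱ b b′ = −χ b (b′+w)·(ρ b (b′+w) − ρ b b′)·G b (b′+w)` with a unit shift `‖w‖∞ ≤ 1`, (ρ1)
`|ρ b (b′+w) − ρ b b′| ≤ Bρ₁`, (Gm) and the window sum at radius `N+1`, `Σ_{‖z‖∞≤N+1}(‖z‖∞+1)⁻ᵐ ≤ W`:
`Σ_{b′∈S′} e^{(γ∕(2n))‖b′−b‖∞}·|k₀ⁱ b b′| ≤ e^{(γ∕(2n))(N+1)}·Bρ₁·2ᵐA·W` (m = 3: `≍ A·B·R₀·n⁻²`). [folklore] -/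
theorem rowMass_k0_interior_le (hγ : 0 ≤ γ) (hA : 0 ≤ A) (hB : 0 ≤ Bρ₁) (hw : supNorm w ≤ 1)
    (hχ : ∀ b b', χ b b' = if supNorm (b' - b) ≤ N then 1 else 0)
    (hρ : ∀ b b', |ρ b (b' + w) - ρ b b'| ≤ Bρ₁) (hG : ∀ b b', |G b b'| ≤ A / ((supNorm (b' - b) : ℝ) + 1) ^ m)
    (hW : ∑ z ∈ box 4 (N + 1), (((supNorm z : ℝ) + 1) ^ m)⁻¹ ≤ W)
    (hk : ∀ b b', k₀i b b' = -(χ b (b' + w) * (ρ b (b' + w) - ρ b b') * G b (b' + w))) (b : Pt) (S' : Finset Pt) :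
    ∑ b' ∈ S', Real.exp ((γ / (2 * n)) * (supNorm (b' - b) : ℝ)) * |k₀i b b'|
      ≤ Real.exp ((γ / (2 * n)) * ((N + 1 : ℕ) : ℝ)) * (Bρ₁ * (2 ^ m * A) * W) := by
  have hshift : ∀ b', (((supNorm (b' + w - b) : ℝ) + 1) ^ m)⁻¹ ≤ 2 ^ m * (((supNorm (b' - b) : ℝ) + 1) ^ m)⁻¹ := by
    intro b'
    have h := inv_pow_unit_shift_le m (b' - b) hw
    rwa [show b' - b + w = b' + w - b by abel] at h
  have hpt : ∀ b', |k₀i b b'| ≤ (fun z : Pt => Bρ₁ * (2 ^ m * A) * (((supNorm z : ℝ) + 1) ^ m)⁻¹) (b' - b) := by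
    intro b'
    simp only
    rw [hk, abs_neg, abs_mul, abs_mul]
    have hGw : |G b (b' + w)| ≤ A * (((supNorm (b' + w - b) : ℝ) + 1) ^ m)⁻¹ := by rw [← div_eq_mul_inv]; exact hG b (b' + w)
    calc |χ b (b' + w)| * |ρ b (b' + w) - ρ b b'| * |G b (b' + w)|
        ≤ 1 * Bρ₁ * (A * (2 ^ m * (((supNorm (b' - b) : ℝ) + 1) ^ m)⁻¹)) :=
          mul_le_mul (mul_le_mul (abs_window_le_one hχ b (b' + w)) (hρ b b') (abs_nonneg _) zero_le_one)
            (hGw.trans (mul_le_mul_of_nonneg_left (hshift b') hA)) (abs_nonneg _) (mul_nonneg zero_le_one hB)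
      _ = Bρ₁ * (2 ^ m * A) * (((supNorm (b' - b) : ℝ) + 1) ^ m)⁻¹ := by ring
  have hsupp : ∀ b', k₀i b b' ≠ 0 → supNorm (b' - b) ≤ N + 1 := by
    intro b' hne
    refine window_shift_support hχ hw b b' (fun h0 => hne ?_)
    rw [hk, h0]; ring
  have h := rowMass_le_of_window (n := n) (N := N + 1) hγ b (φ := fun z : Pt => Bρ₁ * (2 ^ m * A) * (((supNorm z : ℝ) + 1) ^ m)⁻¹) hpt hsupp S'
  refine h.trans (mul_le_mul_of_nonneg_left ?_ (Real.exp_pos _).le)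
  rw [← Finset.mul_sum]
  exact mul_le_mul_of_nonneg_left hW (by positivity)

/-- **(K₀, SHELL) ROW MASS** (row GAMMA-6 (W)): for `k₀ˢ b b′ = −(χ b (b′+w) − χ b b′)·ρ b b′·G b (b′+w)` with a unit shift `‖w‖∞ ≤ 1`, `1 ≤ N`, (ρ0) and (Gm):
the jump of `χ` lives on `N−1 < ‖b′−b‖∞ ≤ N+1` (`≤ 160(N+1)³` points) where the shifted leg is `≤ 4ᵐA∕(N+1)ᵐ`, so
`Σ_{b′∈S′} e^{(γ∕(2n))‖b′−b‖∞}·|k₀ˢ b b′| ≤ e^{(γ∕(2n))(N+1)}·Bρ₀·A·(160·4ᵐ·(N+1)³∕(N+1)ᵐ)` (m = 3: `10240·Bρ₀·A ≍ A·B·n⁻²`, NO power of `N`). [folklore] -/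
theorem rowMass_k0_shell_le (hγ : 0 ≤ γ) (hA : 0 ≤ A) (hB : 0 ≤ Bρ₀) (hw : supNorm w ≤ 1) (hN : 1 ≤ N)
    (hχ : ∀ b b', χ b b' = if supNorm (b' - b) ≤ N then 1 else 0)
    (hρ : ∀ b b', |ρ b b'| ≤ Bρ₀) (hG : ∀ b b', |G b b'| ≤ A / ((supNorm (b' - b) : ℝ) + 1) ^ m)
    (hk : ∀ b b', k₀s b b' = -((χ b (b' + w) - χ b b') * ρ b b' * G b (b' + w))) (b : Pt) (S' : Finset Pt) :
    ∑ b' ∈ S', Real.exp ((γ / (2 * n)) * (supNorm (b' - b) : ℝ)) * |k₀s b b'|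
      ≤ Real.exp ((γ / (2 * n)) * ((N + 1 : ℕ) : ℝ)) * (Bρ₀ * A * (160 * 4 ^ m * (((N : ℝ) + 1) ^ 3 / ((N : ℝ) + 1) ^ m))) := by
  classical
  have hN' : (1 : ℝ) ≤ N := by exact_mod_cast hN
  -- pointwise majorant supported on the thick shell
  set c : ℝ := Bρ₀ * (2 ^ m * A) * ((((N : ℝ) + 1) ^ m)⁻¹ * 2 ^ m) with hc
  have hc0 : 0 ≤ c := by positivity
  set φ : Pt → ℝ := fun z => if N - 1 < supNorm z then c else 0 with hφ
  have hφ0 : ∀ z, 0 ≤ φ z := fun z => by simp only [hφ]; split_ifs <;> positivity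
  have hpt : ∀ b', |k₀s b b'| ≤ φ (b' - b) := by
    intro b'
    by_cases hne : χ b (b' + w) - χ b b' = 0
    · rw [hk, hne]; simp [hφ0]
    obtain ⟨hlo, _⟩ := window_jump_support hχ hw hN b b' hne
    simp only [hφ, if_pos hlo]
    rw [hk, abs_neg, abs_mul, abs_mul]
    have hshift : (((supNorm (b' + w - b) : ℝ) + 1) ^ m)⁻¹ ≤ 2 ^ m * (((supNorm (b' - b) : ℝ) + 1) ^ m)⁻¹ := by
      have h := inv_pow_unit_shift_le m (b' - b) hw
      rwa [show b' - b + w = b' + w - b by abel] at h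
    have hlo' : (N : ℝ) ≤ (supNorm (b' - b) : ℝ) + 1 := by
      have : N - 1 + 1 ≤ supNorm (b' - b) + 1 := by omega
      rw [Nat.sub_add_cancel hN] at this
      exact_mod_cast (this : N ≤ supNorm (b' - b) + 1)
    have hpow : (((supNorm (b' - b) : ℝ) + 1) ^ m)⁻¹ ≤ (((N : ℝ) + 1) ^ m)⁻¹ * 2 ^ m := by
      rw [inv_le_iff_one_le_mul₀ (by positivity)]
      have h2 : (N : ℝ) + 1 ≤ 2 * ((supNorm (b' - b) : ℝ) + 1) := by linarith
      have h3 : ((N : ℝ) + 1) ^ m ≤ 2 ^ m * ((supNorm (b' - b) : ℝ) + 1) ^ m := by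
        rw [← mul_pow]; exact pow_le_pow_left₀ (by positivity) h2 m
      calc (1 : ℝ) = (((N : ℝ) + 1) ^ m)⁻¹ * ((N : ℝ) + 1) ^ m := by field_simp
        _ ≤ (((N : ℝ) + 1) ^ m)⁻¹ * (2 ^ m * ((supNorm (b' - b) : ℝ) + 1) ^ m) := mul_le_mul_of_nonneg_left h3 (by positivity)
        _ = (((N : ℝ) + 1) ^ m)⁻¹ * 2 ^ m * ((supNorm (b' - b) : ℝ) + 1) ^ m := by ring
    have hGw : |G b (b' + w)| ≤ A * (2 ^ m * ((((N : ℝ) + 1) ^ m)⁻¹ * 2 ^ m)) := by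
      calc |G b (b' + w)| ≤ A / ((supNorm (b' + w - b) : ℝ) + 1) ^ m := hG b (b' + w)
        _ = A * (((supNorm (b' + w - b) : ℝ) + 1) ^ m)⁻¹ := div_eq_mul_inv _ _
        _ ≤ A * (2 ^ m * (((supNorm (b' - b) : ℝ) + 1) ^ m)⁻¹) := mul_le_mul_of_nonneg_left hshift hA
        _ ≤ A * (2 ^ m * ((((N : ℝ) + 1) ^ m)⁻¹ * 2 ^ m)) :=
            mul_le_mul_of_nonneg_left (mul_le_mul_of_nonneg_left hpow (by positivity)) hA
    calc |χ b (b' + w) - χ b b'| * |ρ b b'| * |G b (b' + w)| ≤ 1 * Bρ₀ * (A * (2 ^ m * ((((N : ℝ) + 1) ^ m)⁻¹ * 2 ^ m))) :=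
          mul_le_mul (mul_le_mul (abs_window_jump_le_one hχ b b' w) (hρ b b') (abs_nonneg _) zero_le_one) hGw (abs_nonneg _)
            (mul_nonneg zero_le_one hB)
      _ = c := by rw [hc]; ring
  have hsupp : ∀ b', k₀s b b' ≠ 0 → supNorm (b' - b) ≤ N + 1 := by
    intro b' hne
    have hne' : χ b (b' + w) - χ b b' ≠ 0 := by
      intro h0; apply hne; rw [hk, h0]; ring
    exact (window_jump_support hχ hw hN b b' hne').2
  have h := rowMass_le_of_window (n := n) (N := N + 1) hγ b hpt hsupp S'
  refine h.trans (mul_le_mul_of_nonneg_left ?_ (Real.exp_pos _).le)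
  refine (sum_box_indicator_shell_le hN hc0).trans (le_of_eq ?_)
  rw [hc, show (4 : ℝ) ^ m = 2 ^ m * 2 ^ m by rw [← mul_pow]; norm_num, div_eq_mul_inv]
  ring

/-- **(K₀) THE PLAIN KERNEL's ROW MASS, ASSEMBLED** (row GAMMA-6 (W)): `k₀ = k₀ⁱ + k₀ˢ` (`SliceLoopPairing.kernel_leibniz`) ⟹
`Σ_{b′∈S′} e^{(γ∕(2n))‖b′−b‖∞}·|k₀ b b′| ≤ e^{(γ∕(2n))(N+1)}·(Bρ₁·2ᵐA·W + Bρ₀·A·160·4ᵐ(N+1)³∕(N+1)ᵐ)` (window sum `W` at radius `N+1`) — the `M₀` of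
`pp_of_pair` ∕ `pp_of_pairs` ∕ `pp_of_leibniz` for one term. [folklore] -/
theorem rowMass_k0_le (hγ : 0 ≤ γ) (hA : 0 ≤ A) (hB₀ : 0 ≤ Bρ₀) (hB₁ : 0 ≤ Bρ₁) (hw : supNorm w ≤ 1) (hN : 1 ≤ N)
    (hχ : ∀ b b', χ b b' = if supNorm (b' - b) ≤ N then 1 else 0)
    (hρ₀ : ∀ b b', |ρ b b'| ≤ Bρ₀) (hρ₁ : ∀ b b', |ρ b (b' + w) - ρ b b'| ≤ Bρ₁)
    (hG : ∀ b b', |G b b'| ≤ A / ((supNorm (b' - b) : ℝ) + 1) ^ m)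
    (hW : ∑ z ∈ box 4 (N + 1), (((supNorm z : ℝ) + 1) ^ m)⁻¹ ≤ W)
    (hk₀ : ∀ b b', k₀ b b' = -(χ b (b' + w) * (ρ b (b' + w) - ρ b b') * G b (b' + w)) - (χ b (b' + w) - χ b b') * ρ b b' * G b (b' + w))
    (b : Pt) (S' : Finset Pt) :
    ∑ b' ∈ S', Real.exp ((γ / (2 * n)) * (supNorm (b' - b) : ℝ)) * |k₀ b b'|
      ≤ Real.exp ((γ / (2 * n)) * ((N + 1 : ℕ) : ℝ))
          * (Bρ₁ * (2 ^ m * A) * W + Bρ₀ * A * (160 * 4 ^ m * (((N : ℝ) + 1) ^ 3 / ((N : ℝ) + 1) ^ m))) := by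
  set k₀i : Pt → Pt → ℝ := fun b b' => -(χ b (b' + w) * (ρ b (b' + w) - ρ b b') * G b (b' + w)) with hki
  set k₀s : Pt → Pt → ℝ := fun b b' => -((χ b (b' + w) - χ b b') * ρ b b' * G b (b' + w)) with hks
  have e : ∀ b', k₀ b b' = k₀i b b' + k₀s b b' := fun b' => by rw [hk₀]; simp only [hki, hks]; ring
  have hi := rowMass_k0_interior_le (n := n) hγ hA hB₁ hw hχ hρ₁ hG hW (k₀i := k₀i) (fun _ _ => rfl) b S'
  have hs := rowMass_k0_shell_le (n := n) hγ hA hB₀ hw hN hχ hρ₀ hG (k₀s := k₀s) (fun _ _ => rfl) b S'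
  calc ∑ b' ∈ S', Real.exp ((γ / (2 * n)) * (supNorm (b' - b) : ℝ)) * |k₀ b b'|
      = ∑ b' ∈ S', Real.exp ((γ / (2 * n)) * (supNorm (b' - b) : ℝ)) * |k₀i b b' + k₀s b b'| := by simp_rw [e]
    _ ≤ (∑ b' ∈ S', Real.exp ((γ / (2 * n)) * (supNorm (b' - b) : ℝ)) * |k₀i b b'|)
        + ∑ b' ∈ S', Real.exp ((γ / (2 * n)) * (supNorm (b' - b) : ℝ)) * |k₀s b b'| := by
          rw [← Finset.sum_add_distrib]
          refine Finset.sum_le_sum fun b' _ => ?_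
          rw [← mul_add]
          exact mul_le_mul_of_nonneg_left (abs_add_le _ _) (Real.exp_pos _).le
    _ ≤ _ := by rw [mul_add]; exact add_le_add hi hs

/-! ## The m = 3 instances (the R-γ-15 channel, repaired) -/

/-- **(K̃)₃**: degree `−3` long leg (`(Δ_yF)·R` of the placement table), `W₃ = 1 + 80N`:
`Σ_{b′} e^{(γ∕(2n))‖b′−b‖∞}·|k̃ b b′| ≤ e^{(γ∕(2n))N}·Bρ₀·A·(1 + 80N)` — LINEAR in the window radius; road size `A₁|y|·B·R₀·n⁻¹`. [folklore] -/
theorem rowMass_kt_le_three (hγ : 0 ≤ γ) (hA : 0 ≤ A) (hB : 0 ≤ Bρ₀)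
    (hχ : ∀ b b', χ b b' = if supNorm (b' - b) ≤ N then 1 else 0)
    (hρ : ∀ b b', |ρ b b'| ≤ Bρ₀) (hG : ∀ b b', |G b b'| ≤ A / ((supNorm (b' - b) : ℝ) + 1) ^ 3)
    (hkt : ∀ b b', kt b b' = χ b b' * ρ b b' * G b b') (b : Pt) (S' : Finset Pt) :
    ∑ b' ∈ S', Real.exp ((γ / (2 * n)) * (supNorm (b' - b) : ℝ)) * |kt b b'|
      ≤ Real.exp ((γ / (2 * n)) * N) * (Bρ₀ * A * (1 + 80 * (N : ℝ))) :=
  rowMass_kt_le (n := n) hγ hA hB hχ hρ hG (sum_box_inv_cube_le N) hkt b S'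

/-- **(K₀)₃**: degree `−3` long leg, `W₃(N+1) = 1 + 80(N+1)`, shell constant `160·4³·1 = 10240`:
`Σ_{b′} e^{(γ∕(2n))‖b′−b‖∞}·|k₀ b b′| ≤ e^{(γ∕(2n))(N+1)}·(Bρ₁·8A·(1 + 80(N+1)) + Bρ₀·A·10240)` — road size `A₁|y|·B·(80R₀ + O(1))·n⁻²`. [folklore] -/
theorem rowMass_k0_le_three (hγ : 0 ≤ γ) (hA : 0 ≤ A) (hB₀ : 0 ≤ Bρ₀) (hB₁ : 0 ≤ Bρ₁) (hw : supNorm w ≤ 1) (hN : 1 ≤ N)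
    (hχ : ∀ b b', χ b b' = if supNorm (b' - b) ≤ N then 1 else 0)
    (hρ₀ : ∀ b b', |ρ b b'| ≤ Bρ₀) (hρ₁ : ∀ b b', |ρ b (b' + w) - ρ b b'| ≤ Bρ₁)
    (hG : ∀ b b', |G b b'| ≤ A / ((supNorm (b' - b) : ℝ) + 1) ^ 3)
    (hk₀ : ∀ b b', k₀ b b' = -(χ b (b' + w) * (ρ b (b' + w) - ρ b b') * G b (b' + w)) - (χ b (b' + w) - χ b b') * ρ b b' * G b (b' + w))
    (b : Pt) (S' : Finset Pt) :
    ∑ b' ∈ S', Real.exp ((γ / (2 * n)) * (supNorm (b' - b) : ℝ)) * |k₀ b b'|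
      ≤ Real.exp ((γ / (2 * n)) * ((N + 1 : ℕ) : ℝ)) * (Bρ₁ * (8 * A) * (1 + 80 * ((N + 1 : ℕ) : ℝ)) + Bρ₀ * A * 10240) := by
  have h := rowMass_k0_le (n := n) hγ hA hB₀ hB₁ hw hN hχ hρ₀ hρ₁ hG (sum_box_inv_cube_le (N + 1)) hk₀ b S'
  refine h.trans (le_of_eq ?_)
  have hN1 : ((N : ℝ) + 1) ≠ 0 := by positivity
  congr 1
  rw [show ((N : ℝ) + 1) ^ 3 / ((N : ℝ) + 1) ^ 3 = 1 from div_self (pow_ne_zero 3 hN1)]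
  norm_num

end Summit.QuantumFields.BalabanUV.Beta.FP.SliceLoopWindowTerms

end
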